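import Summits.BirchSwinnertonDyer.BirchSwinnertonDyer.Theses.ShaPrimaryTransfer
import Summits.BirchSwinnertonDyer.BirchSwinnertonDyer.Theorems.ShaPrimaryTransferFiniteShaComponentTransferGaussianTwistDoor14613
import Summits.BirchSwinnertonDyer.BirchSwinnertonDyer.Theorems.ShaPrimaryTransferFiniteShaComponentTransferAdmissibleDoor
import Summits.BirchSwinnertonDyer.BirchSwinnertonDyer.Theorems.Rank1ResidualIntModelReduction
import Literature.NumberTheory.EllipticCurves.KubertTate14613GaussianDescent
import Literature.NumberTheory.EllipticCurves.LocalReductionKrausMinimality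
import Literature.NumberTheory.EllipticCurves.ComplexMultiplicationLocalFactorsAux
import Literature.NumberTheory.EllipticCurves.LutzNagellGeneralWeierstrass
import Literature.NumberTheory.EllipticCurves.BSDRootNumberSmallConductorRankProofs
import Mathlib.Tactic.NormNum.Prime
import HarnessLib

/-!
# BirchSwinnertonDyer / ShaPrimaryTransfer — crux `FiniteShaComponentTransfer` (stmt-BirchSwinnertonDyer-22356):
# the door prime `5` of the rank-2 twist `E_{146/13}^{(-4)}` is ADMISSIBLE — so T is IDLE on this curve

Helper file of prover seat `bsd-line-spt-p1` g21 (`--supports stmt-22356 --as helper`). THEOREMS ONLY.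
`W = E_{146/13}^{(-4)} = [0, −10097, 0, 26253136, −9740900416]` (the tree's `quadraticTwist (-4)` of
`E_{146/13} = [-133, -1898, -24674, 0, 0]`) has rank `2`, no rational `5`-torsion and `t₅(W) = 0` by the `5`-descent over
`ℚ(i)` (tree `KubertTate14613GaussianDescent`).  Here:

* `twist_eq` — the twist model (elliptic: `…GaussianTwistDoor14613.isElliptic_twist`); `isGloballyMinimal_twist` — it is a GLOBAL MINIMAL MODEL (Kraus's test at `2`:
  `v₂(Δ) = 17 < 24`, `2⁸ ∤ c₄ = 2⁴·23190001`, `2⁸ ∤ c₆ + 2⁶`; Silverman's `q¹² ∤ Δ = 2¹⁷·13⁵·73⁵·269` elsewhere);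
* `natCard_point_five_twist` — `#W̃(𝔽₅) = 10` (`y² = x³ + 3x² + x + 4`), so **`a₅(W) = −4`**
  (`frobeniusTrace_five_twist`) and `5` is a prime of GOOD ORDINARY reduction (`goodOrdinary_five_twist`): the open
  door `p₀ = 5` is X2-ADMISSIBLE;
* `natCard_point_three_twist` — `#W̃(𝔽₃) = 3` (`y² = x³ + x² + x + 2`), so **`E_{146/13}^{(-4)}(ℚ)_tors = 0`**
  (`torsionOrder_twist_eq_one`: `#E(ℚ)_tors ∣ gcd(#W̃(𝔽₃), #W̃(𝔽₅)) = gcd(3, 10) = 1`, Knapp Thm. 5.1(c)); in particular the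
  twist has NO rational `5`-torsion — its door at `5` is not a rational-torsion door;
* **`analyticRank_twist_eq_mordellWeilRank`**, **`analyticRank_twist_eq_two`** — granting KatoTransfer's items X2
  (`AnalyticRankLeSelmerCorank`), X3 (`PadicOrderLeAnalyticRankAtOnePrime`) and the Kato bound (`KatoRankBound`) ONLY,
  `ord_{s=1} L(E_{146/13}^{(-4)}, s) = rank = 2` (tree `analyticRank_eq_mordellWeilRank_of_admissibleDoor`): on this rank-`2`
  curve outside the rational-`5`-torsion classes the transfer statement T is not needed — the `ℚ(i)`-descent opened an
  admissible door directly.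

* `analyticRank_twist_le_two_of_X2` (X2 alone ⇒ `r_an ≤ 2`), `analyticRank_twist_eq_two_of_X2_of_GZK` (X2 + Gross–Zagier–Kolyvagin
  ⇒ `r_an = 2`; no X3, no Kato, no T).

T is UNCHANGED (conjecture-grade at analytic rank ≥ 2); X2, X3, Kato are NOT proved here; BSD is NOT proved by any of this.

## References

* [SilvermanAEC2009] J. H. Silverman, *AEC*, 2nd ed., VII.1 Remark 1.1, VII.5 Prop. 5.1, VIII.8, X.§2.
* [Kraus1989] A. Kraus, *Quelques remarques à propos des invariants c₄, c₆ et Δ d'une courbe elliptique*, Prop. 2.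
* [GreenbergLNM1716] R. Greenberg, LNM 1716 (1999), §1.
* [Knapp1993] A. W. Knapp, *Elliptic Curves*, Ch. V §1 Thm. 5.1(c).
* [Darmon2004] H. Darmon, *Rational Points on Modular Elliptic Curves*, Thm. 3.22.
-/

-- D-0017: single-problem summit, so `Summit.BirchSwinnertonDyer.BirchSwinnertonDyer.…` repeats a namespace BY DESIGN.
set_option linter.dupNamespace false
set_option autoImplicit false

noncomputable section

open scoped Classical
open Literature.NumberTheory.EllipticCurves WeierstrassCurve
open Literature.NumberTheory.EllipticCurves.Rank1Residual.X11RankOneCertificates (discOf c4Of c6Of)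
open Summit.BirchSwinnertonDyer.BirchSwinnertonDyer.Theses.ShaPrimaryTransfer
open Summit.BirchSwinnertonDyer.BirchSwinnertonDyer.Theorems.ShaPrimaryTransferAdmissibleDoor
open Summit.BirchSwinnertonDyer.BirchSwinnertonDyer.Theorems.ShaPrimaryTransferGaussianTwistDoor14613 (isElliptic_twist)
open Summit.BirchSwinnertonDyer.BirchSwinnertonDyer.Rank1Residual

namespace Summit.BirchSwinnertonDyer.BirchSwinnertonDyer.Theorems.ShaPrimaryTransferGaussianTwistDoor14613Admissible

/-! ## §1 The twist model -/

/-- **`E_{146/13}^{(-4)} = [0, −10097, 0, 26253136, −9740900416]`** (`b₂ = 10097`, `b₄ = 3281642`, `b₆ = 608806276`;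
tree `quadraticTwist d = [0, d b₂/4, 0, d² b₄/2, d³ b₆/4]`). [cite: SilvermanAEC2009, X.§2] -/
theorem twist_eq : (kubertTateFive (((146 : ℤ) : ℚ)) (((13 : ℤ) : ℚ))).quadraticTwist (-4) =
    (⟨((0 : ℤ) : ℚ), ((-10097 : ℤ) : ℚ), ((0 : ℤ) : ℚ), ((26253136 : ℤ) : ℚ), ((-9740900416 : ℤ) : ℚ)⟩ :
      WeierstrassCurve ℚ) := by
  rw [KubertTate14613Descent.curve_eq]
  ext <;> simp [quadraticTwist, WeierstrassCurve.b₂, WeierstrassCurve.b₄, WeierstrassCurve.b₆] <;> norm_num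

/-! ## §2 Global minimality of the twist model -/

/-- `Δ = 2¹⁷·13⁵·73⁵·269`, `c₄ = 371040016`, `c₆ = −2045777636800` of the integer model (kernel evaluation). [folklore] -/
private theorem invariants_model :
    discOf [0, -10097, 0, 26253136, -9740900416] = 27138964218649310789632 ∧
    c4Of [0, -10097, 0, 26253136, -9740900416] = 371040016 ∧
    c6Of [0, -10097, 0, 26253136, -9740900416] = -2045777636800 := by
  refine ⟨?_, ?_, ?_⟩ <;> decide

/-- **`[0, −10097, 0, 26253136, −9740900416]` is a global minimal model**: Kraus's test at `2` (`2²⁴ ∤ Δ`,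
`2⁸ ∤ c₄`, `2⁸ ∤ c₆ + 2⁶`) and `q¹² ∤ Δ = 2¹⁷·13⁵·73⁵·269` at every odd prime `q`
(tree `isGloballyMinimal_of_int_kraus`). [cite: Kraus1989, Prop. 2] [cite: SilvermanAEC2009, VII.1 Remark 1.1 and VIII.8] -/
theorem isGloballyMinimal_model :
    (⟨((0 : ℤ) : ℚ), ((-10097 : ℤ) : ℚ), ((0 : ℤ) : ℚ), ((26253136 : ℤ) : ℚ), ((-9740900416 : ℤ) : ℚ)⟩ :
      WeierstrassCurve ℚ).IsGloballyMinimal := by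
  obtain ⟨hD, hc4, hc6⟩ := invariants_model
  refine WeierstrassCurve.isGloballyMinimal_of_int_kraus 0 (-10097) 0 26253136 (-9740900416) fun q hq ↦ ?_
  rcases eq_or_ne q 2 with rfl | h2
  · refine Or.inr (Or.inl ⟨rfl, ?_, ?_, ?_⟩)
    · rw [hD]; norm_num
    · rw [hc4]; norm_num
    · rw [hc6]; norm_num
  · refine Or.inl fun h ↦ ?_
    obtain ⟨h12, -⟩ := h
    rw [hD] at h12
    have hq1 : (q : ℤ) ∣ 27138964218649310789632 := dvd_trans (dvd_pow_self _ (by norm_num)) h12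
    have hdvdN : q ∣ 2 ^ 17 * 13 ^ 5 * 73 ^ 5 * 269 := by
      have e : ((2 ^ 17 * 13 ^ 5 * 73 ^ 5 * 269 : ℕ) : ℤ) = 27138964218649310789632 := by norm_num
      exact Int.natCast_dvd_natCast.mp (e ▸ hq1)
    have hpi := Nat.Prime.prime hq
    -- `q ∈ {2, 13, 73, 269}`, and `q¹² ∤ Δ` for `q = 13, 73, 269`
    rcases hpi.dvd_or_dvd hdvdN with h | h
    · rcases hpi.dvd_or_dvd h with h | h
      · rcases hpi.dvd_or_dvd h with h | h
        · exact h2 ((Nat.prime_dvd_prime_iff_eq hq Nat.prime_two).mp (hpi.dvd_of_dvd_pow h))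
        · have := (Nat.prime_dvd_prime_iff_eq hq (by norm_num : Nat.Prime 13)).mp (hpi.dvd_of_dvd_pow h)
          subst this; revert h12; norm_num
      · have := (Nat.prime_dvd_prime_iff_eq hq (by norm_num : Nat.Prime 73)).mp (hpi.dvd_of_dvd_pow h)
        subst this; revert h12; norm_num
    · have := (Nat.prime_dvd_prime_iff_eq hq (by norm_num : Nat.Prime 269)).mp h
      subst this; revert h12; norm_num

/-- **The twist model `E_{146/13}^{(-4)}` is globally minimal.** [cite: Kraus1989, Prop. 2] [cite: SilvermanAEC2009, VIII.8] -/
theorem isGloballyMinimal_twist :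
    ((kubertTateFive (((146 : ℤ) : ℚ)) (((13 : ℤ) : ℚ))).quadraticTwist (-4)).IsGloballyMinimal := by
  rw [twist_eq]; exact isGloballyMinimal_model

/-- The tree's integral model of the twist is the integer equation `[0, −10097, 0, 26253136, −9740900416]`.
[cite: SilvermanAEC2009, VIII.8] -/
theorem integralModelInt_twist :
    haveI := isGloballyMinimal_twist
    integralModelInt ((kubertTateFive (((146 : ℤ) : ℚ)) (((13 : ℤ) : ℚ))).quadraticTwist (-4)) =
      ⟨0, -10097, 0, 26253136, -9740900416⟩ := by
  haveI := isGloballyMinimal_twist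
  refine IntModel.integralModelInt_eq_of_map_eq _ ?_
  rw [IntModel.map_mk_int, twist_eq]

/-! ## §3 Reduction at `5`: `#W̃(𝔽₅) = 10`, `a₅ = −4`, good ordinary -/

/-- The reduction modulo `5` of the integer model: `y² = x³ + 3x² + x + 4` over `𝔽₅`. [folklore] -/
private theorem map_zmod_five :
    (⟨0, -10097, 0, 26253136, -9740900416⟩ : WeierstrassCurve ℤ).map (Int.castRingHom (ZMod 5)) =
      (⟨0, 3, 0, 1, 4⟩ : WeierstrassCurve (ZMod 5)) := by
  ext <;> simp [WeierstrassCurve.map] <;> decide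

/-- **`#W̃(𝔽₅) = 10`**: the affine solutions of `y² = x³ + 3x² + x + 4` over `𝔽₅` are `9` (kernel count), plus `O`.
[cite: SilvermanAEC2009, V.2] -/
theorem natCard_point_five_twist :
    Nat.card (((⟨0, -10097, 0, 26253136, -9740900416⟩ : WeierstrassCurve ℤ).map
      (Int.castRingHom (ZMod 5))).toAffine.Point) = 10 := by
  rw [map_zmod_five, natCard_point_eq_one_add_card (F := ZMod 5) _ (by decide)]
  have h : Fintype.card {xy : ZMod 5 × ZMod 5 //
      xy.2 ^ 2 + (⟨0, 3, 0, 1, 4⟩ : WeierstrassCurve (ZMod 5)).a₁ * xy.1 * xy.2 +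
        (⟨0, 3, 0, 1, 4⟩ : WeierstrassCurve (ZMod 5)).a₃ * xy.2 =
      xy.1 ^ 3 + (⟨0, 3, 0, 1, 4⟩ : WeierstrassCurve (ZMod 5)).a₂ * xy.1 ^ 2 +
        (⟨0, 3, 0, 1, 4⟩ : WeierstrassCurve (ZMod 5)).a₄ * xy.1 + (⟨0, 3, 0, 1, 4⟩ : WeierstrassCurve (ZMod 5)).a₆} = 9 := by
    decide +kernel
  rw [h]

/-- **`a₅(E_{146/13}^{(-4)}) = −4`** (`= 5 + 1 − 10`; as for `E_{146/13}` itself, `(−1/5) = +1`). [cite: SilvermanAEC2009, V.2] -/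
theorem frobeniusTrace_five_twist :
    haveI := isGloballyMinimal_twist
    ((kubertTateFive (((146 : ℤ) : ℚ)) (((13 : ℤ) : ℚ))).quadraticTwist (-4)).frobeniusTrace 5 = -4 := by
  haveI := isGloballyMinimal_twist
  rw [IntModel.frobeniusTrace_eq integralModelInt_twist natCard_point_five_twist]
  norm_num

/-- **`5` is a prime of good ORDINARY reduction of `E_{146/13}^{(-4)}`** (`5 ∤ Δ_min = 2¹⁷·13⁵·73⁵·269`, `5 ∤ a₅ = −4`):
the door prime of the `ℚ(i)`-descent is X2-admissible. [cite: SilvermanAEC2009, VII.5 Prop. 5.1(a)] -/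
theorem goodOrdinary_five_twist :
    haveI := isGloballyMinimal_twist
    haveI : Fact (Nat.Prime 5) := ⟨Nat.prime_five⟩
    ((kubertTateFive (((146 : ℤ) : ℚ)) (((13 : ℤ) : ℚ))).quadraticTwist (-4)).HasGoodReductionAtPrime 5 ∧
      ¬ ((5 : ℕ) : ℤ) ∣ ((kubertTateFive (((146 : ℤ) : ℚ)) (((13 : ℤ) : ℚ))).quadraticTwist (-4)).frobeniusTrace 5 := by
  haveI := isGloballyMinimal_twist
  haveI : Fact (Nat.Prime 5) := ⟨Nat.prime_five⟩
  refine ⟨hasGoodReductionAtPrime_of_not_dvd _ 5 ?_, ?_⟩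
  · rw [IntModel.minimalDiscriminantInt_eq integralModelInt_twist]
    have hΔ : (⟨0, -10097, 0, 26253136, -9740900416⟩ : WeierstrassCurve ℤ).Δ = 27138964218649310789632 := by
      norm_num [WeierstrassCurve.Δ, WeierstrassCurve.b₂, WeierstrassCurve.b₄, WeierstrassCurve.b₆, WeierstrassCurve.b₈]
    rw [hΔ]; norm_num
  · rw [frobeniusTrace_five_twist]; decide

/-! ## §4 The rational torsion of the twist is trivial -/

/-- The reduction modulo `3` of the integer model: `y² = x³ + x² + x + 2` over `𝔽₃`. [folklore] -/
private theorem map_zmod_three :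
    (⟨0, -10097, 0, 26253136, -9740900416⟩ : WeierstrassCurve ℤ).map (Int.castRingHom (ZMod 3)) =
      (⟨0, 1, 0, 1, 2⟩ : WeierstrassCurve (ZMod 3)) := by
  ext <;> simp [WeierstrassCurve.map] <;> decide

/-- **`#W̃(𝔽₃) = 3`**: the affine solutions of `y² = x³ + x² + x + 2` over `𝔽₃` are `(2, ±1)`, plus `O`.
[cite: SilvermanAEC2009, V.2] -/
theorem natCard_point_three_twist :
    Nat.card (((⟨0, -10097, 0, 26253136, -9740900416⟩ : WeierstrassCurve ℤ).map
      (Int.castRingHom (ZMod 3))).toAffine.Point) = 3 := by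
  rw [map_zmod_three, natCard_point_eq_one_add_card (F := ZMod 3) _ (by decide)]
  have h : Fintype.card {xy : ZMod 3 × ZMod 3 //
      xy.2 ^ 2 + (⟨0, 1, 0, 1, 2⟩ : WeierstrassCurve (ZMod 3)).a₁ * xy.1 * xy.2 +
        (⟨0, 1, 0, 1, 2⟩ : WeierstrassCurve (ZMod 3)).a₃ * xy.2 =
      xy.1 ^ 3 + (⟨0, 1, 0, 1, 2⟩ : WeierstrassCurve (ZMod 3)).a₂ * xy.1 ^ 2 +
        (⟨0, 1, 0, 1, 2⟩ : WeierstrassCurve (ZMod 3)).a₄ * xy.1 + (⟨0, 1, 0, 1, 2⟩ : WeierstrassCurve (ZMod 3)).a₆} = 2 := by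
    decide +kernel
  rw [h]

/-- **`E_{146/13}^{(-4)}(ℚ)_tors = 0`**: `#E(ℚ)_tors` divides `#W̃(𝔽₃) = 3` and `#W̃(𝔽₅) = 10` (reduction of torsion at the
good primes `3, 5` of a globally minimal equation with `a₁ = 0`, tree `torsionOrder_dvd_reductionPointCount`), hence equals
`1`.  In particular the twist has no rational `5`-torsion. [cite: Knapp1993, Ch. V §1 Thm. 5.1(c)] -/
theorem torsionOrder_twist_eq_one :
    haveI := isElliptic_twist
    ((kubertTateFive (((146 : ℤ) : ℚ)) (((13 : ℤ) : ℚ))).quadraticTwist (-4)).torsionOrder = 1 := by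
  haveI := isElliptic_twist
  haveI := isGloballyMinimal_twist
  haveI : Fact (Nat.Prime 3) := ⟨Nat.prime_three⟩
  haveI : Fact (Nat.Prime 5) := ⟨Nat.prime_five⟩
  have hΔ : (⟨0, -10097, 0, 26253136, -9740900416⟩ : WeierstrassCurve ℤ).Δ = 27138964218649310789632 := by
    norm_num [WeierstrassCurve.Δ, WeierstrassCurve.b₂, WeierstrassCurve.b₄, WeierstrassCurve.b₆, WeierstrassCurve.b₈]
  have h3 := LutzNagellGeneral.torsionOrder_dvd_reductionPointCount ((kubertTateFive (((146 : ℤ) : ℚ)) (((13 : ℤ) : ℚ))).quadraticTwist (-4))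
    3 (Or.inl (by decide)) (by rw [IntModel.minimalDiscriminantInt_eq integralModelInt_twist, hΔ]; norm_num)
  have h5 := LutzNagellGeneral.torsionOrder_dvd_reductionPointCount ((kubertTateFive (((146 : ℤ) : ℚ)) (((13 : ℤ) : ℚ))).quadraticTwist (-4))
    5 (Or.inl (by decide)) (by rw [IntModel.minimalDiscriminantInt_eq integralModelInt_twist, hΔ]; norm_num)
  rw [WeierstrassCurve.reductionPointCount, integralModelInt_twist] at h3 h5
  rw [natCard_point_three_twist] at h3
  rw [natCard_point_five_twist] at h5
  have h1 : ((kubertTateFive (((146 : ℤ) : ℚ)) (((13 : ℤ) : ℚ))).quadraticTwist (-4)).torsionOrder ∣ Nat.gcd 3 10 :=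
    Nat.dvd_gcd h3 h5
  exact Nat.dvd_one.mp (by simpa using h1)

/-! ## §5 T is idle on this curve: X2 + X3 + Kato give `r_an = rank = 2` -/

/-- **`ord_{s=1} L(E_{146/13}^{(-4)}, s) = rank E_{146/13}^{(-4)}(ℚ)` from X2 + X3 + Kato ALONE** (no T, no O as items):
the `ℚ(i)`-descent opened the admissible door `p₀ = 5` (`t₅ = 0`, good ordinary) on this globally minimal rank-`2`
curve without rational `5`-torsion (tree `analyticRank_eq_mordellWeilRank_of_admissibleDoor`). CONDITIONAL on the
route items `hX2`, `hX3`, `hK`. [cite: GreenbergLNM1716, §1 (pp. 54–57)] [cite: SilvermanAEC2009, Thm. X.4.2] -/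
theorem analyticRank_twist_eq_mordellWeilRank (hX2 : AnalyticRankLeSelmerCorank)
    (hX3 : PadicOrderLeAnalyticRankAtOnePrime) (hK : KatoRankBound) :
    haveI := isElliptic_twist
    ((kubertTateFive (((146 : ℤ) : ℚ)) (((13 : ℤ) : ℚ))).quadraticTwist (-4)).analyticRank =
      ((kubertTateFive (((146 : ℤ) : ℚ)) (((13 : ℤ) : ℚ))).quadraticTwist (-4)).mordellWeilRank := by
  haveI := isElliptic_twist
  haveI := isGloballyMinimal_twist
  haveI : Fact (Nat.Prime 5) := ⟨Nat.prime_five⟩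
  haveI : IsCyclotomicExtension {4} ℚ (CyclotomicField 4 ℚ) := CyclotomicField.isCyclotomicExtension 4 ℚ
  obtain ⟨hgood, hord⟩ := goodOrdinary_five_twist
  exact analyticRank_eq_mordellWeilRank_of_admissibleDoor hX2 hX3 hK _ 5 le_rfl hgood hord
    (KubertTate14613GaussianDescent.shaCorank_five_twist_eq_zero (CyclotomicField 4 ℚ))

/-- **`ord_{s=1} L(E_{146/13}^{(-4)}, s) = 2` from X2 + X3 + Kato alone** (rank `2` is unconditional,
tree `KubertTate14613GaussianDescent.mordellWeilRank_twist_eq_two`). CONDITIONAL on `hX2`, `hX3`, `hK`; T idle;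
BSD for this curve is NOT thereby proved unconditionally. [cite: GreenbergLNM1716, §1 (pp. 54–57)] [cite: SilvermanAEC2009, Exercise 10.16] -/
theorem analyticRank_twist_eq_two (hX2 : AnalyticRankLeSelmerCorank)
    (hX3 : PadicOrderLeAnalyticRankAtOnePrime) (hK : KatoRankBound) :
    haveI := isElliptic_twist
    ((kubertTateFive (((146 : ℤ) : ℚ)) (((13 : ℤ) : ℚ))).quadraticTwist (-4)).analyticRank = 2 := by
  haveI := isElliptic_twist
  haveI : IsCyclotomicExtension {4} ℚ (CyclotomicField 4 ℚ) := CyclotomicField.isCyclotomicExtension 4 ℚ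
  rw [analyticRank_twist_eq_mordellWeilRank hX2 hX3 hK]
  exact KubertTate14613GaussianDescent.mordellWeilRank_twist_eq_two (CyclotomicField 4 ℚ)

/-- **Under X2 ALONE: `ord_{s=1} L(E_{146/13}^{(-4)}, s) ≤ 2`** (leg 1 at the admissible door `5`: `r_an ≤ s₅ = rank + t₅ = 2 + 0`).
CONDITIONAL on `hX2` only. [cite: GreenbergLNM1716, §1 (pp. 54–57)] -/
theorem analyticRank_twist_le_two_of_X2 (hX2 : AnalyticRankLeSelmerCorank) :
    haveI := isElliptic_twist
    ((kubertTateFive (((146 : ℤ) : ℚ)) (((13 : ℤ) : ℚ))).quadraticTwist (-4)).analyticRank ≤ 2 := by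
  haveI := isElliptic_twist
  haveI := isGloballyMinimal_twist
  haveI : Fact (Nat.Prime 5) := ⟨Nat.prime_five⟩
  haveI : IsCyclotomicExtension {4} ℚ (CyclotomicField 4 ℚ) := CyclotomicField.isCyclotomicExtension 4 ℚ
  obtain ⟨hgood, hord⟩ := goodOrdinary_five_twist
  have h := hX2 _ 5 le_rfl hgood hord
  have hid := ((kubertTateFive (((146 : ℤ) : ℚ)) (((13 : ℤ) : ℚ))).quadraticTwist (-4)).selmerCorank_eq_mordellWeilRank_add_holds 5
  have ht := KubertTate14613GaussianDescent.shaCorank_five_twist_eq_zero (CyclotomicField 4 ℚ)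
  have hr := KubertTate14613GaussianDescent.mordellWeilRank_twist_eq_two (CyclotomicField 4 ℚ)
  omega

/-- **Under X2 and Gross–Zagier–Kolyvagin: `ord_{s=1} L(E_{146/13}^{(-4)}, s) = 2`** — rank `2` is unconditional, so GZK
(the tree's named fact `rank_eq_analyticRank_of_analyticRank_le_one`, a theorem in print) excludes `r_an ∈ {0, 1}`, and X2
at the door prime `5` caps `r_an ≤ 2`. CONDITIONAL on `hX2` (open) and `hGZK` (in print); no X3, no Kato, no T.
[cite: Darmon2004, Thm. 3.22] [cite: GreenbergLNM1716, §1 (pp. 54–57)] -/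
theorem analyticRank_twist_eq_two_of_X2_of_GZK (hX2 : AnalyticRankLeSelmerCorank)
    (hGZK : rank_eq_analyticRank_of_analyticRank_le_one) :
    haveI := isElliptic_twist
    ((kubertTateFive (((146 : ℤ) : ℚ)) (((13 : ℤ) : ℚ))).quadraticTwist (-4)).analyticRank = 2 := by
  haveI := isElliptic_twist
  haveI : IsCyclotomicExtension {4} ℚ (CyclotomicField 4 ℚ) := CyclotomicField.isCyclotomicExtension 4 ℚ
  refine analyticRank_eq_two_of_le_two_of_two_le_mordellWeilRank _ hGZK (analyticRank_twist_le_two_of_X2 hX2) ?_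
  rw [KubertTate14613GaussianDescent.mordellWeilRank_twist_eq_two (CyclotomicField 4 ℚ)]

end Summit.BirchSwinnertonDyer.BirchSwinnertonDyer.Theorems.ShaPrimaryTransferGaussianTwistDoor14613Admissible

end
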